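import Mathlib
import Literature.Probability.Percolation.Z2PivotalMeasure
import Literature.Probability.Percolation.FourArmGarban
import HarnessLib

/-!
# ZdFourArmQuasiMult

Topic `Literature/Probability/Percolation`. Named literature fact(s) relocated by the gate from `Summits/CriticalPhenomena/CardyFormulaZ2/Theorems/CardyMeckeFlipFlipErgodicityZ2StubLatticeSecondMomentOfQuasiMult.lean`
(accept-time relocation of `[cite]`d propositions written inline in a Summits proposal; human ruling 2026-08-15).
Sources: DuminilCopinManolescuTassion2021, GarbanPeteSchramm2013Pivotal, Nolin2008.

* `Literature.Probability.Percolation.DuminilCopinManolescuTassion2021_zdFourArm_lowerBound`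
* `Literature.Probability.Percolation.DuminilCopinManolescuTassion2021_zdFourArm_quasiMult`
* `Literature.Probability.Percolation.Nolin2008_zdEdgeFourArmQuasiMult`
-/

namespace Literature.Probability.Percolation

open MeasureTheory Set Filter Topology
open Literature.Probability.Percolation Literature.Probability.Percolation.QuadCrossing
open Literature.Probability.LatticeModels
open scoped ENNReal

/-- **Quasi-multiplicativity of the four-arm probability with the inner annulus shrunk to a
single bond**, critical bond percolation on `ℤ²`.  P. Nolin, *Near-critical percolation in two
dimensions*, EJP 13 (2008), Prop. 17 [arXiv 0711.4948: Prop. 16] (Quasi-multiplicativity):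
"`P̂(A_{j,σ}(n₁,n₂)) P̂(A_{j,σ}(n₂,n₃)) ≍ P̂(A_{j,σ}(n₁,n₃))` uniformly in `p`, `P̂` between `P_p`
and `P_{1-p}` and `n₀(j) ≤ n₁ < n₂ < n₃ ≤ L(p)`", where (§4.1) "`n₀(j) = 0` for `j = 1,…,6`" and
"for `j = 1` … `A_{j,σ}(0,N)` just denotes the existence of a black path `0 ⇝ ∂S_N`" — i.e. the
inner radius `n₁ = 0` is the case of arms FROM A SINGLE SITE; §8.1: "Most of the results presented
here (the separation of arms, …) … remain true on other regular lattices like the square lattice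
… We can also handle bond percolation in this way. We refer the reader to the original paper of
Kesten [1987]"; C. Garban, G. Pete, O. Schramm, JAMS 26 (2013), §2.1: "`α_k^η(η,R)` … the `k`-arm
probability from a single site to radius `R`", the display
"`c_k α_k(r₁,r₂) α_k(r₂,r₃) ≤ α_k(r₁,r₃) ≤ α_k(r₁,r₂) α_k(r₂,r₃)` for some absolute constant
`c_k > 0`", and p. 10: for "critical bond percolation on `ℤ²` … all ingredients remain valid that
do not use the uniqueness and conformal invariance … the separation of interfaces phenomena".
RENDERING (at most weaker than printed): `j = 4`, alternating colours, `p = 1/2` only, the LOWER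
inequality only, with a threshold `N₀` on the middle radius; the "single site" of site
percolation is, for bond percolation, a single bond (GPS 2013 p. 3: "a bit (vertex in site
percolation or edge in bond percolation)"), and its four-arm event to radius `m` is the tree's
cluster-form `edgeFourArm [-m,m]² 0 0` of `Z2PivotalMeasure.lean` (the event normalising GPS's
pivotal measures, `z2EdgeFourArmProb`); the annulus factor is the cluster-form
`fourArmTwoClusters m N` of `FourArmGarban.lean` (as in `Garban2011_fourArm_multiscale`,
`zdCritFourArmProb`): there are `N₀` and `c > 0` with
`c · P(edgeFourArm [-m,m]² 0 0) · P(fourArmTwoClusters m N) ≤ P(edgeFourArm [-N,N]² 0 0)` for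
`N₀ ≤ m < N`.  Originally H. Kesten, Comm. Math. Phys. 109 (1987) (site and bond percolation on
`ℤ²`). [cite: Nolin2008, Prop. 17 with n₁ = n₀(4) = 0, and §8.1 (arXiv 0711.4948: Prop. 16)] [cite: GarbanPeteSchramm2013Pivotal, §2.1 (quasi-multiplicativity display; α_k^η(η,R) from a single site) and p. 10 (bond percolation on ℤ²)] [file Probability/Percolation/ZdFourArmQuasiMult] -/
def Nolin2008_zdEdgeFourArmQuasiMult : Prop :=
  ∃ N₀ : ℕ, ∃ c : ℝ, 0 < c ∧ ∀ m N : ℕ, N₀ ≤ m → m < N →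
    c * ((Literature.Probability.Percolation.bondPercolation
        (Literature.Probability.LatticeModels.zdGraph 2) Literature.Probability.Percolation.half).real
        (Literature.Probability.Percolation.edgeFourArm
          (↑(Literature.Probability.LatticeModels.box 2 m) :
            Set (Literature.Probability.LatticeModels.Site 2)) 0 0) *
      (Literature.Probability.Percolation.bondPercolation
        (Literature.Probability.LatticeModels.zdGraph 2) Literature.Probability.Percolation.half).real
        (Literature.Probability.Percolation.fourArmTwoClusters m N)) ≤
    (Literature.Probability.Percolation.bondPercolation
        (Literature.Probability.LatticeModels.zdGraph 2) Literature.Probability.Percolation.half).real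
      (Literature.Probability.Percolation.edgeFourArm
        (↑(Literature.Probability.LatticeModels.box 2 N) :
          Set (Literature.Probability.LatticeModels.Site 2)) 0 0)

/-- **Quasi-multiplicativity of the alternating four-arm probability of square annuli**,
critical bond percolation on `ℤ²`.  H. Duminil-Copin, I. Manolescu, V. Tassion, *Planar
random-cluster model: fractal properties of the critical phase*, PTRF 181 (2021)
(arXiv 2007.14707), §6.2, Prop. 6.3 (Quasimultiplicativity), verbatim: "Fix `1 ≤ q < 4` and `σ`.
There exist `c₇ = c₇(σ,q) > 0` and `C₇ = C₇(σ,q) > 0` such that for every `R ≥ r ≥ r_σ`,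
`c₇ φ_{ℤ²}[A_σ(r,R)] ≤ φ_{ℤ²}[A_σ(r,ρ)] φ_{ℤ²}[A_σ(ρ,R)] ≤ C₇ φ_{ℤ²}[A_σ(r,R)]`" (setting of §6:
`Λ_n` spanned by `{-n,…,n}²`; arms "from `∂Λ_r` to `∂Λ_R`", "of type `1` if composed of primal
edges that are all open, of type `0` if composed of dual edges that are all dual-open",
`A_σ(r,R)` = "`k` disjoint arms … of type `σ₁,…,σ_k`, when indexed in counterclockwise order";
at `q = 1`, "`φ` is a product measure … Bernoulli percolation", `p_c(1) = 1/2`; also Nolin 2008,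
Prop. 17 and §8.1; originally Kesten 1987).  RENDERING (at most weaker than printed): `q = 1`,
`σ = 1010`, the UPPER inequality only, `1 ≤ r ≤ ρ ≤ R` (Prop. 6.8 ibid. quantifies `A_{1010}(r,R)`
over "every `R ≥ r ≥ 1`", so `r_{1010} ≤ 1`), the event in the tree's cluster form
`fourArmTwoClusters r R` (`FourArmGarban.lean`, as for `Garban2011_fourArm_multiscale` and the
sibling fact `DuminilCopinManolescuTassion2021_zdFiveArm_upperBound`): there is `C > 0` with
`P(fourArmTwoClusters r ρ) · P(fourArmTwoClusters ρ R) ≤ C · P(fourArmTwoClusters r R)`.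
[cite: DuminilCopinManolescuTassion2021, §6.2 Prop. 6.3 (quasimultiplicativity), upper inequality, q = 1, σ = 1010 (arXiv 2007.14707 numbering)] [cite: Nolin2008, Prop. 17 and §8.1 (arXiv 0711.4948: Prop. 16)] [file Probability/Percolation/ZdFourArmQuasiMult] -/
def DuminilCopinManolescuTassion2021_zdFourArm_quasiMult : Prop :=
  ∃ C : ℝ, 0 < C ∧ ∀ r ρ R : ℕ, 1 ≤ r → r ≤ ρ → ρ ≤ R →
    (Literature.Probability.Percolation.bondPercolation
        (Literature.Probability.LatticeModels.zdGraph 2) Literature.Probability.Percolation.half).real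
        (Literature.Probability.Percolation.fourArmTwoClusters r ρ) *
      (Literature.Probability.Percolation.bondPercolation
        (Literature.Probability.LatticeModels.zdGraph 2) Literature.Probability.Percolation.half).real
        (Literature.Probability.Percolation.fourArmTwoClusters ρ R) ≤
    C * (Literature.Probability.Percolation.bondPercolation
        (Literature.Probability.LatticeModels.zdGraph 2) Literature.Probability.Percolation.half).real
      (Literature.Probability.Percolation.fourArmTwoClusters r R)

/-- **The alternating four-arm exponent of critical bond percolation on `ℤ²` is strictly less
than `2`, two radii.**  H. Duminil-Copin, I. Manolescu, V. Tassion, PTRF 181 (2021)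
(arXiv 2007.14707), §6.3, Prop. 6.8, verbatim: "Fix `1 ≤ q < 4`. There exist `c₁₁, c₁₂ > 0` such
that for every `R ≥ r ≥ 1`, `φ_{ℤ²}[A_{1010}(r,R)] ≥ c₁₁ (r π₁⁺(R))/(R π₁⁺(r)) ≥ c₁₂ (r/R)^{2-c₁₂}`"
("That the probability of the four-arm event is polynomially larger than that of the five-arm
event, that is than `(r/R)²`, is a standard consequence of [RSW]"; for site-`𝕋` this is the tree's
`Werner2009_fourArm_lowerBound`, Werner 2009 Lecture 6 §3; Nolin 2008 §8.1 for the square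
lattice: "the a-priori estimate `P_{p_c}(0 ⇝^{4,σ₄} ∂S_N) ≥ N^{-2+α}` … coming from the `5`-arm
exponent, remains true").  RENDERING (at most weaker than printed): `q = 1` (Bernoulli bond
percolation at `p = 1/2`), the outer inequality only, the event in the tree's cluster form
`fourArmTwoClusters r R` (`FourArmGarban.lean`): there is `c > 0` with
`c (r/R)^{2-c} ≤ P(fourArmTwoClusters r R)` for all `1 ≤ r ≤ R`.
[cite: DuminilCopinManolescuTassion2021, §6.3 Prop. 6.8 (four-arm lower bound), q = 1 (arXiv 2007.14707 numbering)] [cite: Nolin2008, §8.1 (a priori bound for four arms on the square lattice)] [file Probability/Percolation/ZdFourArmLowerBound] -/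
def DuminilCopinManolescuTassion2021_zdFourArm_lowerBound : Prop :=
  ∃ c : ℝ, 0 < c ∧ ∀ r R : ℕ, 1 ≤ r → r ≤ R →
    c * ((r : ℝ) / R) ^ (2 - c) ≤
      (Literature.Probability.Percolation.bondPercolation
        (Literature.Probability.LatticeModels.zdGraph 2) Literature.Probability.Percolation.half).real
        (Literature.Probability.Percolation.fourArmTwoClusters r R)

/-! ### The uniform second moment -/

end Literature.Probability.Percolation
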